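import Literature.NumberTheory.QuadraticForms.HilbertSymbol
import HarnessLib

/-!
# Elements with prescribed local Hilbert symbols (O'Meara 71:19)

Topic `NumberTheory/QuadraticForms`; namespace `Literature`. One named fact (a published theorem not
yet provable at the Mathlib pin, `def … : Prop` with citation):

* `exists_hilbertSymbol_eq_neg_one_iff K` : **O'Meara, Thm. 71:19 with Cor. 71:19a** — let `T` be
  a set consisting of an even number of discrete or real spots of the algebraic number field `K`,
  and let `a ∈ K` be a non-square at every spot of `T`; then there is `θ ∈ K` (necessarily
  `θ ≠ 0`) whose Hilbert symbol `(θ, a)_𝔭` is `-1` for `𝔭 ∈ T` and `+1` for every other spot `𝔭`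
  of `K` (finite or infinite). Mathlib has no single type of places, so `T` is given as a finite
  set `S` of finite places `v : HeightOneSpectrum (𝓞 K)` (symbol computed in
  `v.adicCompletion K`) together with a finite set `T` of real infinite places
  `w : InfinitePlace K` (symbol computed in `w.Completion`), with `|S| + |T|` even.

  This is the existence statement behind the classification of quaternion algebras over `K`
  (existence of a quaternion algebra with prescribed even ramification set): Vignéras (LNM 800,
  Ch. III §3) obtains it as `K^× ∩ ∏_{v ∈ T} i_v n(L_A^×) ≠ ∅` for `L = K(√a)` and `|T|` even, from
  the norm index theorem `[K_A^× : K^× n(L_A^×)] = 2` (III Thm. 3.7) in the proofs of Thm. 3.8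
  and of Propriété III; O'Meara's proof of 71:19 likewise combines the norm index `= 2`
  (Prop. 65:21), the surjectivity of the local symbol (63:13) and Hilbert reciprocity (71:18,
  here `hilbertReciprocity`). None of these (class field theory for quadratic extensions) is in
  Mathlib. The consequence for quaternion algebras is drawn in
  `Literature/NumberTheory/Automorphic/` (files `QuaternionAlgebraSplitting`,
  `QuaternionAlgebraExistence`).

Conventions as in `HilbertSymbol.lean`: `hilbertSymbol F a b = 1` iff `a x² + b y² = 1` is
soluble in `F`; `K : Type` (universe `0`) as in `hilbertReciprocity` and the adelic files.

## References

* O. T. O'Meara, *Introduction to quadratic forms*, Grundlehren 117, Springer (1963), §71,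
  Thm. 71:19 and Cor. 71:19a (also 63:13, 65:21, 71:18 for the inputs of its proof).
* M.-F. Vignéras, *Arithmétique des algèbres de quaternions*, LNM 800 (1980), Ch. III §3,
  Thm. 3.7, Thm. 3.8 (proof), Propriété III.
-/

noncomputable section

open NumberField IsDedekindDomain

namespace Literature.NumberTheory.QuadraticForms

/-- **Elements with prescribed Hilbert symbols** (O'Meara, Thm. 71:19 with Cor. 71:19a): let `K`
be an algebraic number field, `S` a finite set of finite places and `T` a finite set of real
places of `K` with `|S| + |T|` even, and let `a ∈ K` be a non-square in `K_v` for every `v ∈ S`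
and in `K_w` for every `w ∈ T`. Then there is `θ ∈ K`, `θ ≠ 0`, such that the Hilbert symbol
`(θ, a)_v` (in the completion `K_v`) equals `-1` exactly for the finite places `v ∈ S`, and
`(θ, a)_w` (in `K_w`) equals `-1` exactly for the infinite places `w ∈ T` — i.e. `(θ, a)_𝔭 = -1`
for `𝔭 ∈ S ∪ T` and `(θ, a)_𝔭 = 1` at all remaining places, complex ones included. (71:19 asserts
the existence of such a pair `θ, a`; 71:19a adds that `a` can be any element that is a non-square
at all places of `S ∪ T`. Equivalently, for `L = K(√a)`: `θ` is a local norm from `L` exactly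
outside `S ∪ T` — Vignéras III §3, Thm. 3.7 and the proof of Thm. 3.8.)
[cite: Omeara1963, §71 Thm. 71:19 and Cor. 71:19a] -/
def exists_hilbertSymbol_eq_neg_one_iff (K : Type) [Field K] [NumberField K] : Prop :=
  ∀ (a : K) (S : Finset (HeightOneSpectrum (𝓞 K))) (T : Finset (InfinitePlace K)),
    (∀ w ∈ T, w.IsReal) → Even (S.card + T.card) →
    (∀ v ∈ S, ¬ IsSquare (algebraMap K (v.adicCompletion K) a)) →
    (∀ w ∈ T, ¬ IsSquare (algebraMap K w.Completion a)) →
    ∃ θ : K, θ ≠ 0 ∧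
      (∀ v : HeightOneSpectrum (𝓞 K),
        hilbertSymbol (v.adicCompletion K) (algebraMap K _ θ) (algebraMap K _ a) = -1 ↔ v ∈ S) ∧
      (∀ w : InfinitePlace K,
        hilbertSymbol w.Completion (algebraMap K _ θ) (algebraMap K _ a) = -1 ↔ w ∈ T)

end Literature.NumberTheory.QuadraticForms
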